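import Summits.Ventures.Crystal3D.Theorems.StickyWulffConstantCoaxialWallLawBarlowPlateSphere
import Summits.Ventures.Crystal3D.Theorems.StickyWulffConstantCoaxialWallLawEndRowPattern
import HarnessLib

/-!
# Readings of a CLAMPED, MOVED Barlow plate's interior balls (F_layer L2/L3 brick, part 4: cell-level corollaries)

HONEST FRAMING. Venture `Summits/Ventures/Crystal3D` (cell `crystal3d-full`); helper for the crux `CoaxialWallLaw` (stmt-Ventures-19481)
in its role as owner of lane T's debt T-F2 / F_layer.  Census-free, standard axioms; nothing about the crux is claimed; F-C1 not moved.
Transport of `…BarlowSiteReadings(Mirror)` (model coordinates) to a MOVED plate `stacking L s σ` inside a configuration `X` that contains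
the plate on a region `W` ⊇ the radius-2 ball of the ball `b = L q + s` (`…BarlowPlateSphere`), via 19481-p2's transport lemmas
(`isFull_transport_iff`, `isTwinReading_transport_iff`, …EndRowPattern) applied to the pulled-back configuration `X.image (L⁻¹(· − s))`:

* `pullback_image_eq` — `(X.image (L.symm (· − s))).image (L · + s) = X`;
* **`isFull_plateBall`** (`s (k−1) = s k = 1` ⇒ `IsFull X L b`), **`isFull_mirror_plateBall`** (`−1, −1` ⇒ `IsFull X (basalMirror ≫ L) b`),
  **`isTwinReading_plateBall_up`** (`+,−` ⇒ `IsTwinReading X L (L e₃) b`), **`isTwinReading_plateBall_down`** (`−,+` ⇒ `IsTwinReading X L (−L e₃) b`)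
  — the source balls of F_layer's per-strip word nets are MOVING for every in-plane root (full move at c-layers, glide at h-layers).
WHAT THIS IS NOT: no walker count; F-C1 not moved.
-/

noncomputable section

namespace Summit.Ventures.Crystal3D.Theorems

open Summit.Ventures.Crystal3D Finset
open Literature.MathematicalPhysics.StatisticalMechanics (barlowPos barlowStacking IsHaggSeq barlowPos_mem basalMirror)
open Summit.Ventures.Crystal3D.Cruxes.TextureLiminf.TexShadow (E3 stacking)
open scoped InnerProductSpace

section Plate

variable {σ : ℤ → ℤ} (hσ : IsHaggSeq σ) (L : E3 ≃ₗᵢ[ℝ] E3) (s : E3) {X : Finset E3}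
  (hsep : ∀ p ∈ X, ∀ p' ∈ X, p ≠ p' → 1 ≤ dist p p') {W : Set E3}
  (hplate : ∀ p ∈ stacking L s σ, p ∈ W → p ∈ X) (k i j : ℤ)
  (hW : ∀ x, dist (L (barlowPos 1 (Real.sqrt (2 / 3)) σ k i j) + s) x ≤ 2 → x ∈ W)

open scoped Classical in
/-- The pulled-back configuration pushes forward to `X`. -/
theorem pullback_image_eq (X : Finset E3) (L : E3 ≃ₗᵢ[ℝ] E3) (s : E3) :
    (X.image fun x => L.symm (x - s)).image (fun x => L x + s) = X := by
  rw [image_image]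
  have : ((fun x => L x + s) ∘ fun x => L.symm (x - s)) = id := by
    funext x; simp
  rw [this, image_id]

include hsep hplate hW

open scoped Classical in
/-- The model-coordinate window hypotheses for the pulled-back configuration. -/
theorem plateBall_model_hyps :
    (∀ x ∈ barlowStacking 1 (Real.sqrt (2 / 3)) σ, dist (barlowPos 1 (Real.sqrt (2 / 3)) σ k i j) x = 1 →
        x ∈ X.image fun x => L.symm (x - s)) ∧
    (∀ x ∈ X.image (fun x => L.symm (x - s)), dist (barlowPos 1 (Real.sqrt (2 / 3)) σ k i j) x = 1 →
        x ∈ barlowStacking 1 (Real.sqrt (2 / 3)) σ) := by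
  obtain ⟨hnb, hpure⟩ := barlowPlate_unitSphere σ L s hsep hplate hW
  have hdist : ∀ x : E3, dist (barlowPos 1 (Real.sqrt (2 / 3)) σ k i j) x =
      dist (L (barlowPos 1 (Real.sqrt (2 / 3)) σ k i j) + s) (L x + s) := by
    intro x; rw [dist_add_right, L.dist_map]
  refine ⟨fun x hx hd => ?_, fun x hx hd => ?_⟩
  · have hmem : L x + s ∈ X := hnb _ ⟨x, hx, rfl⟩ (by rw [← hdist]; exact hd)
    exact mem_image.2 ⟨L x + s, hmem, by simp⟩
  · obtain ⟨x₁, hx₁, rfl⟩ := mem_image.1 hx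
    have he : L (L.symm (x₁ - s)) + s = x₁ := by simp
    have hd₁ : dist (L (barlowPos 1 (Real.sqrt (2 / 3)) σ k i j) + s) x₁ = 1 := by rw [← he, ← hdist]; exact hd
    obtain ⟨r, hr, hre⟩ := hpure x₁ hx₁ hd₁
    have : L.symm (x₁ - s) = r := by rw [← hre]; simp
    rw [this]; exact hr

open scoped Classical in
/-- **c-layer `(+,+)` of a clamped moved plate: the ball is FULL in the plate frame `L`.** -/
theorem isFull_plateBall (h₁ : σ (k - 1) = 1) (h₂ : σ k = 1) :
    IsFull X L (L (barlowPos 1 (Real.sqrt (2 / 3)) σ k i j) + s) := by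
  obtain ⟨hnb, -⟩ := plateBall_model_hyps L s hsep hplate k i j hW
  have h := isFull_barlowSite k i j hnb h₁ h₂
  rw [← isFull_transport_iff L s] at h
  rw [pullback_image_eq] at h
  simpa using h

open scoped Classical in
/-- **c-layer `(−,−)`: FULL in the mirror frame `basalMirror ≫ L`.** -/
theorem isFull_mirror_plateBall (h₁ : σ (k - 1) = -1) (h₂ : σ k = -1) :
    IsFull X (basalMirror.trans L) (L (barlowPos 1 (Real.sqrt (2 / 3)) σ k i j) + s) := by
  obtain ⟨hnb, -⟩ := plateBall_model_hyps L s hsep hplate k i j hW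
  have h := isFull_mirror_barlowSite k i j hnb h₁ h₂
  rw [← isFull_transport_iff L s, pullback_image_eq] at h
  exact h

include hσ in
open scoped Classical in
/-- **h-layer `(+,−)`: TWIN READING in the plate frame `L` with normal `L e₃`.** -/
theorem isTwinReading_plateBall_up (h₁ : σ (k - 1) = 1) (h₂ : σ k = -1) :
    IsTwinReading X L (L (EuclideanSpace.single (2 : Fin 3) (1 : ℝ))) (L (barlowPos 1 (Real.sqrt (2 / 3)) σ k i j) + s) := by
  obtain ⟨hnb, hX⟩ := plateBall_model_hyps L s hsep hplate k i j hW
  have h := isTwinReading_barlowSite_up hσ k i j hX hnb h₁ h₂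
  rw [← isTwinReading_transport_iff L s, pullback_image_eq] at h
  simpa using h

include hσ in
open scoped Classical in
/-- **h-layer `(−,+)`: TWIN READING in the plate frame `L` with normal `−L e₃`.** -/
theorem isTwinReading_plateBall_down (h₁ : σ (k - 1) = -1) (h₂ : σ k = 1) :
    IsTwinReading X L (-L (EuclideanSpace.single (2 : Fin 3) (1 : ℝ))) (L (barlowPos 1 (Real.sqrt (2 / 3)) σ k i j) + s) := by
  obtain ⟨hnb, hX⟩ := plateBall_model_hyps L s hsep hplate k i j hW
  have h := isTwinReading_barlowSite_down hσ k i j hX hnb h₁ h₂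
  rw [← isTwinReading_transport_iff L s, pullback_image_eq, map_neg] at h
  simpa using h

end Plate

end Summit.Ventures.Crystal3D.Theorems

end
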